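import Literature.AlgebraicGeometry.HodgeTheory.IntegralHodgeStructureExteriorPowerDiscriminant
import Literature.AlgebraicGeometry.Motives.WeilTypePolarization
import HarnessLib

/-!
# Integral polarizations TRANSPORT along isomorphisms of integral Hodge structures (integrality, unimodularity and the discriminant are
# invariants); Bourbaki's `Q_(k)` as an integral polarization of `Hᵏ(X, ℤ) = HkIntObj X k` ITSELF, along `⋀ᵏH¹(X, ℤ) ≅ Hᵏ(X, ℤ)`

[topic AlgebraicGeometry/HodgeTheory]

Layer `Literature/AlgebraicGeometry/HodgeTheory` (namespaces `Literature.AlgebraicGeometry.HodgeTheory.IntHodgeStructureCat`, §1–§2, and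
`….ComplexTorusCat`, §3).  Lane `lit-hodgefound` (Track 2 foundations library), skeleton seat `lit-hodgefound-skel-1` (generation 60), row
**A1-298** of `run/shared/lean/pub/lit-hodgefound/SKELETON.md`; Layer A1 «`H^k = ⋀^k H¹`»: rows A1-296∕A1-297 polarize prover p35's
`⋀ᵏM = extPowerObj M k` by `ψ_(k)`; p35's `exteriorPowerIntIso X k : (⋀ᵏ H¹(X, ℤ))(cast k·1 = k) ≅ Hᵏ(X, ℤ) = HkIntObj X k`
(`IntegralHodgeStructureExteriorPower` §3, Lange's wedge map `exteriorPowerToForms`) is an isomorphism of INTEGRAL Hodge structures, and this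
file carries the polarization across it.  ONE definition with a body (`ComplexTorusCat.exteriorPowerDetHk`, the induced polarization of
`Hᵏ(X, ℤ)`; built from the tree's `Polarization.cast` and `Polarization.comap`) and THEOREMS; no instance, no named fact (net debt `0`).

## Sources, VERBATIM

C. Voisin, *Hodge Theory and Complex Algebraic Geometry I* [VoisinHodgeI2002] §7.1.2 (p0160: "A sub-Hodge structure of a polarised Hodge
structure is polarised by the restriction of the form"; the tree's `Polarization.comap`: pull-back of a polarization along an injective
morphism of Hodge structures), §7.2.2 (p0142: "`Hᵏ(T, ℤ) = ⋀ᵏ H¹(T, ℤ)`" for a complex torus).  H. Lange, *Abelian Varieties over the Complex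
Numbers* (2023) [Lange2023AbelianVarietiesComplex] §1.1.3 Exercise 1.1.6 (7) (p0027: "the canonical map `∧ⁿH¹(X,ℤ) → Hⁿ(X,ℤ)`, induced by the
cup product, is an isomorphism"), §6.2.4 (p. 310: "the cup product pairing […] yields the Poincaré duality `Hᵖ(X, ℤ) ⥲ H^{2g−p}(X, ℤ)^*`").
D. Huybrechts, *Lectures on K3 Surfaces* [Huybrechts2016K3] Ch. 3 §2.1 (p0056 L9: an isomorphism of integral Hodge structures is a rational
one "which induces an isomorphism on the lattices"), §1.3 (iv)–(v), Def. 1.6 (p0052), Ch. 14 §0.1 (p0330 L25: "`disc Λ := det` […] with respect to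
an arbitrary basis (over `ℤ`)", p0331 L11: "unimodular […] if `disc Λ = ±1`").  N. Bourbaki, *Algèbre* IX [BourbakiAlgebreIX2007] §1 no. 9 (37),
Prop. 10 (p0019–p0020); §2 no. 1 Déf. 1, Prop. 1, Prop. 3 (p0032–p0034).

## What is proved

* §1 TRANSPORT ALONG AN ISOMORPHISM `e : M ≅ N` of integral Hodge structures, for a polarization `ψ` of `N` and its pull-back
  `ψ ∘ e = ψ.comap e.hom.hom`: **`isIntegral_comap`** (integral ⟹ integral; any morphism with injective linear map),
  **`isIso_polarizationToDual_comap_iff`** (`θ_{ψ∘e}` iso ⟺ `θ_ψ` iso: unimodularity is invariant — `e` carries `Λ_M` ONTO `Λ_N`,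
  `map_Λ_eq_of_iso`), **`det_gramMatrix_comap`** (`disc (ψ ∘ e) = disc ψ`: the discriminant is invariant — row A1-297's basis-independence
  `det_toMatrix_eq_cast_det_gramMatrix` on the image basis `e(b_i)`).
* §2 TRANSPORT OF THE WEIGHT (`castFunctor h`, `Polarization.cast`): `isIntegral_cast_iff`, `isIso_polarizationToDual_cast_iff`, `gramMatrix_cast` —
  nothing changes (same space, form and lattice).
* §3 **`ComplexTorusCat.exteriorPowerDetHk X ψ k`**, THE POLARIZATION `Q_(k)` OF `Hᵏ(X, ℤ) = HkIntObj X k` induced by a polarization `ψ` of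
  `H¹(X, ℤ) = H1IntObj X` along `exteriorPowerIntIso X k`: its form on wedges of one-classes is Bourbaki's determinant
  **`exteriorPowerDetHk_form_wedgeOneForms`** (`Q_(k)(α₁ ∧ ⋯ ∧ α_k, β₁ ∧ ⋯ ∧ β_k) = det(ψ(α_i, β_j))`, (37)); it is INTEGRAL when `ψ` is
  (`isIntegral_exteriorPowerDetHk`); its discriminant is **`det_gramMatrix_exteriorPowerDetHk`** `= (disc ψ)^{C(2g−1,k−1)}` (`1 ≤ k`); and
  **`isIso_polarizationToDual_exteriorPowerDetHk_iff`**: for `1 ≤ k ≤ 2g`, `θ : Hᵏ(X, ℤ) ⟶ Hᵏ(X, ℤ)^∨(−k)` is an isomorphism of integral Hodge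
  structures IFF `ψ` is unimodular on `H¹(X, ℤ)` (principal type) — Poincaré duality of `Hᵏ(X, ℤ)` realised by `Q_(k)`, with
  `isIso_polarizationToDual_exteriorPowerDetHk` (all `k`) and `nonempty_HkIntObj_iso_twistedDualObj_of_isIso` (compare the lane's
  `HkIntSelfDualIsoOfUnimodular`, the same self-duality through `X ≅ X̂` and the Fourier transform).

## SCOPE

(a) `exteriorPowerDetHk` depends on the chosen polarization `ψ` of `H¹(X, ℤ)`; no canonical choice is made.  (b) Positivity∕Hodge–Riemann data are
those of the tree's `Polarization` structure, transported by `Polarization.cast`∕`comap` (nothing new is claimed about signs).  (c) Nothing here is a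
case of the Hodge conjecture.

## References

* [VoisinHodgeI2002] C. Voisin, *Hodge Theory and Complex Algebraic Geometry I*, §7.1.2 (p0160), §7.2.2 (p0142), §7.3.1 Def. 7.22–Lemma 7.23 (p0147).
* [Lange2023AbelianVarietiesComplex] H. Lange, *Abelian Varieties over the Complex Numbers* (2023), §1.1.3 Exercise 1.1.6 (7)–(8) (p0027), §6.2.4 (p. 310).
* [Huybrechts2016K3] D. Huybrechts, *Lectures on K3 Surfaces*, Ch. 3 §1.3 (iv)–(v), Def. 1.6 (p0052), §2.1 (p0056); Ch. 14 §0.1 (p0330–p0331).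
* [BourbakiAlgebreIX2007] N. Bourbaki, *Algèbre, Chapitre 9*, §1 no. 9 (37), Prop. 10 (p0019–p0020); §2 no. 1 Déf. 1, Prop. 1, Prop. 3 (p0032–p0034).
-/

noncomputable section

universe u

open CategoryTheory Module Function Submodule

namespace Literature.AlgebraicGeometry.HodgeTheory.IntHodgeStructureCat

open Literature.AlgebraicGeometry.Motives Literature.AlgebraicGeometry.Motives.HodgeStructure

variable {n m : ℤ} {M N : IntHodgeStructureCat.{u} n}

/-! ## §1 Transport of integral polarizations along isomorphisms -/

/-- `e⁻¹ (e v) = v` for an isomorphism of integral Hodge structures. [cite: VoisinHodgeI2002, §7.3.1 Lemma 7.23 (p0147 L19)] -/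
theorem inv_hom_toLinearMap_apply (e : M ≅ N) (v : M.V) : e.inv.hom.toLinearMap (e.hom.hom.toLinearMap v) = v := by
  rw [← comp_toLinearMap_apply, e.hom_inv_id, id_toLinearMap, LinearMap.id_apply]

/-- `e (e⁻¹ w) = w` for an isomorphism of integral Hodge structures. [cite: VoisinHodgeI2002, §7.3.1 Lemma 7.23 (p0147 L19)] -/
theorem hom_inv_toLinearMap_apply (e : M ≅ N) (w : N.V) : e.hom.hom.toLinearMap (e.inv.hom.toLinearMap w) = w := by
  rw [← comp_toLinearMap_apply, e.inv_hom_id, id_toLinearMap, LinearMap.id_apply]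

/-- **The pull-back `ψ ∘ f` of an INTEGRAL polarization along a morphism of integral Hodge structures (injective on `V`) is integral**
(`f(Λ_M) ⊆ Λ_N`). [cite: VoisinHodgeI2002, §7.1.2 (p0160) and §7.3.1 Def. 7.22 (p0147 L15)] [cite: Huybrechts2016K3, Ch. 3 §1.3 Def. 1.6 (p0052 L15)] -/
theorem isIntegral_comap (f : M ⟶ N) (hf : Injective f.hom.toLinearMap) (Q : N.str.Polarization) (hQ : N.IsIntegral Q) :
    M.IsIntegral (Q.comap f.hom hf) :=
  fun u hu v hv ↦ hQ _ (f.map_mem u hu) _ (f.map_mem v hv)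

/-- **UNIMODULARITY IS INVARIANT UNDER ISOMORPHISMS OF INTEGRAL HODGE STRUCTURES**: for `e : M ≅ N` and an integral polarization `ψ` of `N`,
`θ_{ψ∘e} : M ⟶ M^∨(−n)` is an isomorphism iff `θ_ψ : N ⟶ N^∨(−n)` is (`e` carries `Λ_M` onto `Λ_N`, "induces an isomorphism on the lattices").
[cite: Huybrechts2016K3, Ch. 3 §2.1 (p0056 L9) and Ch. 14 §0.1 (p0331 L11)] [cite: VoisinHodgeI2002, §7.3.1 Lemma 7.23 (p0147 L19)] -/
theorem isIso_polarizationToDual_comap_iff (e : M ≅ N) (Q : N.str.Polarization) (hQ : N.IsIntegral Q) :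
    IsIso (polarizationToDual (Q.comap e.hom.hom (bijective_of_iso e).1) (isIntegral_comap e.hom (bijective_of_iso e).1 Q hQ)) ↔
      IsIso (polarizationToDual Q hQ) := by
  rw [isIso_polarizationToDual_iff, isIso_polarizationToDual_iff]
  constructor
  · intro hM φ hφ
    -- `φ ∘ e ∈ Λ_M^∨`; write it as `(ψ∘e)♭ v`, then `ψ♭ (e v) = φ`
    have hφe : φ ∘ₗ e.hom.hom.toLinearMap ∈ dualLattice M.Λ := fun v hv ↦ hφ _ (e.hom.map_mem v hv)
    obtain ⟨v, hv, hvφ⟩ := hM _ hφe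
    refine ⟨e.hom.hom.toLinearMap v, e.hom.map_mem v hv, LinearMap.ext fun w ↦ ?_⟩
    have h := LinearMap.congr_fun hvφ (e.inv.hom.toLinearMap w)
    rw [Polarization.toDualEquiv_apply, Polarization.comap_form_apply, LinearMap.comp_apply, hom_inv_toLinearMap_apply] at h
    rw [Polarization.toDualEquiv_apply, h]
  · intro hN φ hφ
    have hφe : φ ∘ₗ e.inv.hom.toLinearMap ∈ dualLattice N.Λ := fun w hw ↦ hφ _ (e.inv.map_mem w hw)
    obtain ⟨w, hw, hwφ⟩ := hN _ hφe
    refine ⟨e.inv.hom.toLinearMap w, e.inv.map_mem w hw, LinearMap.ext fun v ↦ ?_⟩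
    have h := LinearMap.congr_fun hwφ (e.hom.hom.toLinearMap v)
    rw [Polarization.toDualEquiv_apply, LinearMap.comp_apply, inv_hom_toLinearMap_apply] at h
    rw [Polarization.toDualEquiv_apply, Polarization.comap_form_apply, hom_inv_toLinearMap_apply, h]

/-- **THE DISCRIMINANT IS INVARIANT UNDER ISOMORPHISMS OF INTEGRAL HODGE STRUCTURES**: `disc (ψ ∘ e) = disc ψ` for `e : M ≅ N` (the image
`e(b_i)` of a `ℤ`-basis of `Λ_M` is a `ℤ`-basis of `Λ_N`; the discriminant does not depend on the `ℤ`-basis, row A1-297).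
[cite: Huybrechts2016K3, Ch. 14 §0.1 (p0330 L25) and Ch. 3 §2.1 (p0056 L9)] [cite: BourbakiAlgebreIX2007, §2 no. 1 Déf. 1, Prop. 1 (p0032–p0033)] -/
theorem det_gramMatrix_comap (e : M ≅ N) (Q : N.str.Polarization) (hQ : N.IsIntegral Q) :
    (gramMatrix (Q.comap e.hom.hom (bijective_of_iso e).1) (isIntegral_comap e.hom (bijective_of_iso e).1 Q hQ)).det = (gramMatrix Q hQ).det := by
  let eₗ : M.V ≃ₗ[ℚ] N.V := LinearEquiv.ofBijective e.hom.hom.toLinearMap (bijective_of_iso e)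
  apply Int.cast_injective (α := ℚ)
  -- the image basis `e(b_i)` of `N.V` has `ℤ`-span `e(Λ_M) = Λ_N`
  have hspan : span ℤ (Set.range ((ratBasis M).map eₗ)) = N.Λ := by
    have h1 : Set.range ((ratBasis M).map eₗ) = (e.hom.hom.toLinearMap.restrictScalars ℤ) '' Set.range (ratBasis M) := by
      rw [← Set.range_comp]; rfl
    rw [h1, ← Submodule.map_span, span_int_range_ratBasis, map_Λ_eq_of_iso]
  rw [cast_det_gramMatrix, ← det_toMatrix_eq_cast_det_gramMatrix Q hQ ((ratBasis M).map eₗ) hspan]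
  -- the two Gram matrices agree entrywise, definitionally: `(ψ ∘ e)(b_i, b_j) = ψ(e b_i, e b_j)`
  congr 1

/-! ## §2 Transport of the weight -/

/-- Integrality is unchanged by the transport of the weight (same lattice, same form). [cite: DeligneHodgeII1971, 2.1.13–2.1.14] -/
theorem isIntegral_cast_iff (h : n = m) (Q : M.str.Polarization) : ((castFunctor h).obj M).IsIntegral (Q.cast h) ↔ M.IsIntegral Q := Iff.rfl

/-- Unimodularity is unchanged by the transport of the weight. [cite: DeligneHodgeII1971, 2.1.13–2.1.14] [cite: Huybrechts2016K3, Ch. 14 §0.1 (p0331 L11)] -/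
theorem isIso_polarizationToDual_cast_iff (h : n = m) (Q : M.str.Polarization) (hQ : M.IsIntegral Q) :
    IsIso (polarizationToDual (M := (castFunctor h).obj M) (Q.cast h) ((isIntegral_cast_iff h Q).2 hQ)) ↔ IsIso (polarizationToDual Q hQ) := by
  rw [isIso_polarizationToDual_iff, isIso_polarizationToDual_iff]
  rfl

/-- The Gram matrix is unchanged by the transport of the weight. [cite: DeligneHodgeII1971, 2.1.13–2.1.14] [cite: Huybrechts2016K3, Ch. 14 §0.1 (p0330 L25)] -/
theorem gramMatrix_cast (h : n = m) (Q : M.str.Polarization) (hQ : M.IsIntegral Q) :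
    gramMatrix (M := (castFunctor h).obj M) (Q.cast h) ((isIntegral_cast_iff h Q).2 hQ) = gramMatrix Q hQ := rfl

end Literature.AlgebraicGeometry.HodgeTheory.IntHodgeStructureCat

/-! ## §3 `Q_(k)` as an integral polarization of `Hᵏ(X, ℤ) = HkIntObj X k` -/

namespace Literature.AlgebraicGeometry.HodgeTheory.ComplexTorusCat

open Literature.AlgebraicGeometry.Motives Literature.AlgebraicGeometry.Motives.HodgeStructure
open Literature.Geometry.Kaehler Literature.Geometry.Kaehler.ComplexTorus IntHodgeStructureCat

variable (X : ComplexTorusCat)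

/-- **The polarization `Q_(k)` of `Hᵏ(X, ℤ)`** induced by a polarization `ψ` of `H¹(X, ℤ) = H1IntObj X`: Bourbaki's `ψ_(k) = ψ.exteriorPowerDet k`
on `⋀ᵏH¹(X, ℚ)` (row A1-285), weight transported along `k·1 = k` (`Polarization.cast`) and carried to `Hᵏ(X, ℚ)` along the INVERSE of the
isomorphism of integral Hodge structures `exteriorPowerIntIso X k : ⋀ᵏH¹(X, ℤ) ≅ Hᵏ(X, ℤ)` (Lange's wedge map; `Polarization.comap`).
[cite: Lange2023AbelianVarietiesComplex, §1.1.3 Exercise 1.1.6 (7) (p0027)] [cite: VoisinHodgeI2002, §7.2.2 (p0142) and §7.1.2 (p0160)] [cite: BourbakiAlgebreIX2007, §1 no. 9 (37) (p0019)] -/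
def exteriorPowerDetHk (Q : (H1IntObj X).str.Polarization) (k : ℕ) : (HkIntObj X k).str.Polarization :=
  ((Q.exteriorPowerDet k).cast (mul_one (k : ℤ))).comap (exteriorPowerIntIso X k).inv.hom (bijective_of_iso (exteriorPowerIntIso X k).symm).1

/-- The form of `Q_(k)` on `Hᵏ(X, ℚ)`: pull back along the inverse wedge isomorphism and evaluate Bourbaki's `ψ_(k)`.
[cite: Lange2023AbelianVarietiesComplex, §1.1.3 Exercise 1.1.6 (7) (p0027)] [cite: BourbakiAlgebreIX2007, §1 no. 9 (37) (p0019)] -/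
theorem exteriorPowerDetHk_form_apply (Q : (H1IntObj X).str.Polarization) (k : ℕ) (x y : (HkIntObj X k).V) :
    (exteriorPowerDetHk X Q k).form x y =
      (Q.exteriorPowerDet k).form ((exteriorPowerIntIso X k).inv.hom.toLinearMap x) ((exteriorPowerIntIso X k).inv.hom.toLinearMap y) := rfl

/-- **`Q_(k)(α₁ ∧ ⋯ ∧ α_k, β₁ ∧ ⋯ ∧ β_k) = det(ψ(α_i, β_j))` on `Hᵏ(X, ℚ)`** for one-classes `α_i, β_j ∈ H¹(X, ℚ)` (formula (37), through
`exteriorPowerToForms (α₁ ∧ ⋯ ∧ α_k) = α₁ ∧ ⋯ ∧ α_k = wedgeOneForms`). [cite: BourbakiAlgebreIX2007, §1 no. 9 (37) (p0019)] [cite: Lange2023AbelianVarietiesComplex, §1.1.3 Exercise 1.1.6 (7) (p0027)] -/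
theorem exteriorPowerDetHk_form_wedgeOneForms (Q : (H1IntObj X).str.Polarization) (k : ℕ) (α β : Fin k → rationalForms X.toIsog.Φ 1) :
    (exteriorPowerDetHk X Q k).form (wedgeOneForms X.toIsog.Φ k α) (wedgeOneForms X.toIsog.Φ k β) =
      Matrix.det (Matrix.of fun i j ↦ Q.form (α i) (β j)) := by
  have hw : ∀ γ : Fin k → rationalForms X.toIsog.Φ 1,
      (exteriorPowerIntIso X k).inv.hom.toLinearMap (wedgeOneForms X.toIsog.Φ k γ) = exteriorPower.ιMulti ℚ k γ := fun γ ↦ by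
    have h2 : (exteriorPowerIntIso X k).hom.hom.toLinearMap (exteriorPower.ιMulti ℚ k γ) = wedgeOneForms X.toIsog.Φ k γ :=
      exteriorPowerToForms_ιMulti X.toIsog.Φ k γ
    rw [← h2]
    exact inv_hom_toLinearMap_apply (exteriorPowerIntIso X k) _
  rw [exteriorPowerDetHk_form_apply, hw, hw]
  exact Polarization.exteriorPowerDet_form_ιMulti_ιMulti Q k α β

/-- **`Q_(k)` is an INTEGRAL polarization of `Hᵏ(X, ℤ)` whenever `ψ` is integral on `H¹(X, ℤ)`** (the wedge isomorphism carries
`⋀ᵏ_ℤ H¹(X, ℤ)` onto `Hᵏ(X, ℤ)`). [cite: Huybrechts2016K3, Ch. 3 §1.3 Def. 1.6 (p0052 L15) and §2.1 (p0056 L9)] [cite: Lange2023AbelianVarietiesComplex, §1.1.3 Exercise 1.1.6 (7) (p0027)] -/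
theorem isIntegral_exteriorPowerDetHk (Q : (H1IntObj X).str.Polarization) (hQ : (H1IntObj X).IsIntegral Q) (k : ℕ) :
    (HkIntObj X k).IsIntegral (exteriorPowerDetHk X Q k) :=
  isIntegral_comap _ _ _
    ((isIntegral_cast_iff (M := extPowerObj (H1IntObj X) k) (mul_one (k : ℤ)) (Q.exteriorPowerDet k)).2 (isIntegral_exteriorPowerDet Q hQ k))

/-- **`disc Q_(k) = (disc ψ)^{C(2g−1, k−1)}` on `Hᵏ(X, ℤ)`** (`1 ≤ k`, `g = dim X`).
[cite: BourbakiAlgebreIX2007, §2 no. 1 Déf. 1, Prop. 1 (p0032–p0033)] [cite: Bernstein2009, Fact 7.5.17 (xi) (p. 452)] [cite: Huybrechts2016K3, Ch. 14 §0.1 (p0330 L25)] -/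
theorem det_gramMatrix_exteriorPowerDetHk (Q : (H1IntObj X).str.Polarization) (hQ : (H1IntObj X).IsIntegral Q) {k : ℕ} (hk : 1 ≤ k) :
    (gramMatrix (exteriorPowerDetHk X Q k) (isIntegral_exteriorPowerDetHk X Q hQ k)).det =
      (gramMatrix Q hQ).det ^ (2 * Module.finrank ℂ X.toIsog.E - 1).choose (k - 1) := by
  have h1 := det_gramMatrix_comap (exteriorPowerIntIso X k).symm ((Q.exteriorPowerDet k).cast (mul_one (k : ℤ)))
    ((isIntegral_cast_iff (M := extPowerObj (H1IntObj X) k) (mul_one (k : ℤ)) (Q.exteriorPowerDet k)).2 (isIntegral_exteriorPowerDet Q hQ k))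
  rw [gramMatrix_cast (M := extPowerObj (H1IntObj X) k) (mul_one (k : ℤ)) (Q.exteriorPowerDet k) (isIntegral_exteriorPowerDet Q hQ k)] at h1
  rw [← det_gramMatrix_exteriorPowerDet_H1IntObj X Q hQ hk]
  exact h1

/-- **`θ_{Q_(k)} : Hᵏ(X, ℤ) ⟶ Hᵏ(X, ℤ)^∨(−k)` IS AN ISOMORPHISM OF INTEGRAL HODGE STRUCTURES IFF `ψ` IS UNIMODULAR ON `H¹(X, ℤ)`** (`1 ≤ k ≤ 2g`):
only principal-type polarizations make `Q_(k)` a perfect pairing on `Hᵏ(X, ℤ)` — Poincaré duality of `Hᵏ(X, ℤ)` realised by `Q_(k)`.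
[cite: Lange2023AbelianVarietiesComplex, §6.2.4 (p. 310) and §1.1.3 Exercise 1.1.6 (7)] [cite: BourbakiAlgebreIX2007, §1 no. 9 Prop. 10 (p0020) and §2 no. 1 Prop. 3 (p0034)]
[cite: Huybrechts2016K3, Ch. 14 §0.1 (p0331 L11) and Ch. 3 §2.1 (p0056 L9)] -/
theorem isIso_polarizationToDual_exteriorPowerDetHk_iff (Q : (H1IntObj X).str.Polarization) (hQ : (H1IntObj X).IsIntegral Q) {k : ℕ}
    (hk : 1 ≤ k) (hkg : k ≤ 2 * Module.finrank ℂ X.toIsog.E) :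
    IsIso (polarizationToDual (exteriorPowerDetHk X Q k) (isIntegral_exteriorPowerDetHk X Q hQ k)) ↔ IsIso (polarizationToDual Q hQ) := by
  have h1 := isIso_polarizationToDual_comap_iff (exteriorPowerIntIso X k).symm ((Q.exteriorPowerDet k).cast (mul_one (k : ℤ)))
    ((isIntegral_cast_iff (M := extPowerObj (H1IntObj X) k) (mul_one (k : ℤ)) (Q.exteriorPowerDet k)).2 (isIntegral_exteriorPowerDet Q hQ k))
  rw [isIso_polarizationToDual_cast_iff (M := extPowerObj (H1IntObj X) k) (mul_one (k : ℤ)) (Q.exteriorPowerDet k)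
      (isIntegral_exteriorPowerDet Q hQ k), isIso_polarizationToDual_exteriorPowerDet_H1IntObj_iff X Q hQ hk hkg] at h1
  exact h1

/-- **A UNIMODULAR (principal) integral polarization of `H¹(X, ℤ)` makes `θ_{Q_(k)}` an isomorphism in EVERY degree** (Prop. 10).
[cite: BourbakiAlgebreIX2007, §1 no. 9 Prop. 10 (p0020)] [cite: Lange2023AbelianVarietiesComplex, §6.2.4 (p. 310) and §2.4.4 (p0118 L23)] -/
theorem isIso_polarizationToDual_exteriorPowerDetHk (Q : (H1IntObj X).str.Polarization) (hQ : (H1IntObj X).IsIntegral Q)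
    (hU : IsIso (polarizationToDual Q hQ)) (k : ℕ) :
    IsIso (polarizationToDual (exteriorPowerDetHk X Q k) (isIntegral_exteriorPowerDetHk X Q hQ k)) :=
by
  have h1 := isIso_polarizationToDual_comap_iff (exteriorPowerIntIso X k).symm ((Q.exteriorPowerDet k).cast (mul_one (k : ℤ)))
    ((isIntegral_cast_iff (M := extPowerObj (H1IntObj X) k) (mul_one (k : ℤ)) (Q.exteriorPowerDet k)).2 (isIntegral_exteriorPowerDet Q hQ k))
  rw [isIso_polarizationToDual_cast_iff (M := extPowerObj (H1IntObj X) k) (mul_one (k : ℤ)) (Q.exteriorPowerDet k)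
      (isIntegral_exteriorPowerDet Q hQ k)] at h1
  exact h1.2 (isIso_polarizationToDual_exteriorPowerDet Q hQ hU k)

/-- **`Hᵏ(X, ℤ) ≅ Hᵏ(X, ℤ)^∨(−k)` as integral Hodge structures through `θ_{Q_(k)}`** for a principally polarized complex torus (the lane's
`HkIntSelfDualIsoOfUnimodular` gives the same self-duality through `X ≅ X̂` and the Fourier transform).
[cite: Lange2023AbelianVarietiesComplex, §6.2.4 (p. 310)] [cite: Huybrechts2016K3, Ch. 3 §1.3 (iv)–(v) (p0052)] -/
theorem nonempty_HkIntObj_iso_twistedDualObj_of_isIso (Q : (H1IntObj X).str.Polarization) (hQ : (H1IntObj X).IsIntegral Q)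
    (hU : IsIso (polarizationToDual Q hQ)) (k : ℕ) : Nonempty (HkIntObj X k ≅ twistedDualObj (HkIntObj X k)) :=
  haveI := isIso_polarizationToDual_exteriorPowerDetHk X Q hQ hU k
  ⟨asIso (polarizationToDual (exteriorPowerDetHk X Q k) (isIntegral_exteriorPowerDetHk X Q hQ k))⟩

end Literature.AlgebraicGeometry.HodgeTheory.ComplexTorusCat

end
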